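import Mathlib
import Literature.RingTheory.CohomologyAnnihilator.BirationalTransfer
import HarnessLib

/-!
# Derivation homotopy: `δF` stably annihilates `S`-projective modules over `S[z]/(zⁿ + F)`

Crux `HomologicalConductor.Persistence` (stmt-ResolutionOfSingularities-16484), chain W4.4b, card
A3 `frobenius-flat-homotopy` of res-L1-w44b-idea-1 (ASSIGN v0.6: stub-3 lands A3-W1 `HomotopyLemma`
and A3-W2 `FrobeniusChainRule`). `[OURS · L1 w44b]` replaces the role of NO printed item; it is our
own homological lemma about hypersurface-type stages of the route's ca-tower; NOT a statement of the
manuscript under review, nothing is attributed to its author. AI-drafted (weaker than expert review).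

**The homotopy lemma (exponent one, characteristic-free).** Let `S → B` be commutative rings with
`B = S[z]` monogenic (`Algebra.adjoin S {z} = ⊤`, e.g. `B = S[X]/(Xⁿ + F)` or any quotient of it)
and `zⁿ + F = 0` in `B` for some `F ∈ S`. Let `N` be a `B`-module carrying a *`δ`-connection*
`∇ : N → N`, `∇ (s • m) = δ s • m + s • ∇ m`, for some map `δ : S → S` (for `N` projective over `S`
and `δ` a derivation such a `∇` always exists: compress the coordinatewise derivative of a free
module, `exists_connection`). Then `D := [∇, z]` is `S`-linear, the Leibniz expansion
`Σ_{i+j=n-1} zⁱ D zʲ = [∇, zⁿ] = [∇, -F] = -(δ F)` holds on `N`, and the map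
`ι(m) = -Σ_{i+j=n-1} zⁱ ⊗ D(zʲ m) : N → B ⊗_S N` is `B`-LINEAR (the commutator with `z` telescopes
to `zⁿ ⊗ D m - 1 ⊗ D(zⁿ m) = -F ⊗ D m + 1 ⊗ F D m = 0`) with `μ ∘ ι = (δ F) • 1_N` for the
multiplication `μ : B ⊗_S N → N` (`exists_liftBaseChange_comp_eq_smul_id_of_connection`). As
`B ⊗_S N` is `B`-projective when `N` is `S`-projective (Mathlib's `Module.Projective.tensorProduct`),
`δ F` lies in the STABLE annihilator of every `S`-projective `B`-module — hence kills
`Extⁱ_B(N, -)` for all `i ≥ 1` (`smul_ext_eq_zero_of_derivation`, via the tree's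
`smul_ext_eq_zero_of_linearMap_comp_eq_smul_id`) — with EXPONENT ONE and no hypothesis on the
characteristic. The card's `HomotopyLemma` shape (`B = AdjoinRoot (Xⁿ + C F)`, `∃ P` projective in
`ModuleCat B` with `ι ≫ π = δF • 𝟙`) is `exists_projective_comp_eq_smul_id_adjoinRoot`.

**The Frobenius chain rule** (`frobeniusChainRule`): in characteristic `p` a derivation does not
see `p`-th powers, `δ (F + φᵖ) = δ F` and `δ (uᵖ F) = uᵖ δ F` — the datum `δ F` of `zᵖ + F` is
invariant under Tschirnhaus cleaning and `p`-th power rescaling (card A3-W2).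

Deliberately NOT here: bundled `def`s (the connection, `D`, `ι` are produced inside proofs and
only `∃`-statements are exported), the card's structure claim W3 (refuted by res-L1-w44b-tri-1,
TRIAGE v1) and any use of `CharP` outside `frobeniusChainRule`.
-/

-- single-problem summit: the doubled namespace component is forced
set_option linter.dupNamespace false

noncomputable section

open CategoryTheory CategoryTheory.Abelian
open scoped TensorProduct

universe u v

namespace Summit.ResolutionOfSingularities.ResolutionOfSingularities.Theorems.HomologicalConductor.PersistenceDerivationHomotopy

open Literature.RingTheory.CohomologyAnnihilator

/-! ## Connections on projective modules -/

section Connection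

variable {R S : Type*} [CommRing R] [CommRing S] [Algebra R S]

/-- **Projective modules admit connections.** For a derivation `δ` of `S` and an `S`-projective
module `N` there is an additive `∇ : N → N` with the Leibniz rule `∇ (s • m) = δ s • m + s • ∇ m`:
split `N` off the free module `N →₀ S` (`σ`, retracted by the linear combination map `ε`) and set
`∇ = ε ∘ (coordinatewise δ) ∘ σ`. [folklore] -/
theorem exists_connection (δ : Derivation R S S) (N : Type*) [AddCommGroup N] [Module S N]
    [Module.Projective S N] :
    ∃ nab : N →+ N, ∀ (s : S) (m : N), nab (s • m) = δ s • m + s • nab m := by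
  obtain ⟨σ, hσ⟩ := Module.projective_def'.mp ‹Module.Projective S N›
  have h0 : (δ : S → S) 0 = 0 := map_zero δ
  have hadd : ∀ x y : S, δ (x + y) = δ x + δ y := fun x y => map_add δ x y
  set ε : (N →₀ S) →ₗ[S] N := Finsupp.linearCombination S (id : N → N) with hε
  have hεσ : ∀ m : N, ε (σ m) = m := fun m => by
    change (ε ∘ₗ σ) m = m
    rw [hσ, LinearMap.id_apply]
  have key : ∀ (s : S) (v : N →₀ S),
      Finsupp.mapRange δ h0 (s • v) = δ s • v + s • Finsupp.mapRange δ h0 v := fun s v => by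
    ext a
    simp only [Finsupp.mapRange_apply, Finsupp.smul_apply, Finsupp.add_apply, smul_eq_mul,
      Derivation.leibniz, mul_comm (v a) (δ s)]
    ring
  refine ⟨{ toFun := fun m => ε (Finsupp.mapRange δ h0 (σ m))
            map_zero' := by rw [map_zero σ, Finsupp.mapRange_zero, map_zero ε]
            map_add' := fun m m' => by
              rw [map_add σ, Finsupp.mapRange_add hadd, map_add ε] }, fun s m => ?_⟩
  change ε (Finsupp.mapRange δ h0 (σ (s • m))) = δ s • m + s • ε (Finsupp.mapRange δ h0 (σ m))
  rw [map_smul σ, key, map_add ε, map_smul ε, map_smul ε, hεσ]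

end Connection

/-! ## The homotopy -/

section Homotopy

variable {S : Type u} {B : Type u} [CommRing S] [CommRing B] [Algebra S B]

/-- **Derivation homotopy from a connection.** Let `B` be generated over `S` by `z` with
`zⁿ + F = 0` (`F ∈ S`), `N` a `B`-module and `∇ : N → N` a `δ`-connection
(`∇ (s • m) = δ s • m + s • ∇ m`). Then the homothety `(δ F) • 1_N` factors `B`-LINEARLY through
the multiplication map `μ : B ⊗_S N → N` (`μ = id.liftBaseChange B`, `b ⊗ m ↦ b • m`): there is a
`B`-linear `ι : N → B ⊗_S N` with `μ ∘ ι = (δ F) • id`, namely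
`ι(m) = -Σ_{i+j=n-1} zⁱ ⊗ D(zʲ m)` with `D = [∇, z]` (Leibniz expansion
`Σ zⁱ D zʲ = [∇, zⁿ] = -(δ F)` on `N`; `B`-linearity by telescoping the commutator with `z` to
`zⁿ ⊗ D m - 1 ⊗ D (zⁿ m) = 0`). [folklore] -/
theorem exists_liftBaseChange_comp_eq_smul_id_of_connection {z : B}
    (hz : Algebra.adjoin S {z} = ⊤) {n : ℕ} {F : S} (hzF : z ^ n + algebraMap S B F = 0)
    {N : Type v} [AddCommGroup N] [Module B N] [Module S N] [IsScalarTower S B N]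
    (δ : S → S) (nab : N →+ N) (hnab : ∀ (s : S) (m : N), nab (s • m) = δ s • m + s • nab m) :
    ∃ ι : N →ₗ[B] B ⊗[S] N,
      (LinearMap.id : N →ₗ[S] N).liftBaseChange B ∘ₗ ι = algebraMap S B (δ F) • LinearMap.id := by
  -- the multiplication map
  set μ : B ⊗[S] N →ₗ[B] N := (LinearMap.id : N →ₗ[S] N).liftBaseChange B with hμdef
  have hμ : ∀ (b : B) (m : N), μ (b ⊗ₜ[S] m) = b • m := fun b m =>
    LinearMap.liftBaseChange_tmul B _ b m
  have hzn : z ^ n = -algebraMap S B F := eq_neg_of_add_eq_zero_left hzF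
  -- the `S`-linear operator `D = [∇, z]`
  have hzs : ∀ (s : S) (m : N), z • s • m = s • z • m := fun s m => smul_comm z s m
  let D : N →ₗ[S] N :=
    { toFun := fun m => nab (z • m) - z • nab m
      map_add' := fun m m' => by
        simp only [smul_add, map_add]
        abel
      map_smul' := fun s m => by
        simp only [RingHom.id_apply]
        rw [hzs s m, hnab s (z • m), hnab s m, smul_add, hzs (δ s) m, hzs s (nab m), smul_sub]
        abel }
  have hD : ∀ m : N, D m = nab (z • m) - z • nab m := fun m => rfl
  -- the homotopy `h k m = Σ_{i+j=k-1} zⁱ ⊗ D (zʲ m)`, defined by recursion on `k`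
  let h : ℕ → N → B ⊗[S] N := fun k =>
    Nat.rec (motive := fun _ => N → B ⊗[S] N) (fun _ => 0)
      (fun k hk m => (1 : B) ⊗ₜ[S] D (z ^ k • m) + z • hk m) k
  have h_zero : ∀ m, h 0 m = 0 := fun m => rfl
  have h_succ : ∀ k m, h (k + 1) m = (1 : B) ⊗ₜ[S] D (z ^ k • m) + z • h k m := fun k m => rfl
  -- additivity and `S`-homogeneity
  have h_add : ∀ k (m m' : N), h k (m + m') = h k m + h k m' := by
    intro k
    induction k with
    | zero => intro m m'; simp only [h_zero, add_zero]
    | succ k ih =>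
      intro m m'
      rw [h_succ, h_succ, h_succ, smul_add, map_add, TensorProduct.tmul_add, ih, smul_add]
      abel
  have h_smul : ∀ k (s : S) (m : N), h k (s • m) = s • h k m := by
    intro k
    induction k with
    | zero => intro s m; simp only [h_zero, smul_zero]
    | succ k ih =>
      intro s m
      rw [h_succ, h_succ, smul_comm (z ^ k) s m, map_smul, TensorProduct.tmul_smul, ih,
        smul_comm z s (h k m), smul_add]
  -- the multiplication map evaluates the homotopy to the Leibniz commutator `[∇, zᵏ]`
  have h_mu : ∀ k (m : N), μ (h k m) = nab (z ^ k • m) - z ^ k • nab m := by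
    intro k
    induction k with
    | zero => intro m; simp only [h_zero, map_zero, pow_zero, one_smul, sub_self]
    | succ k ih =>
      intro m
      rw [h_succ, map_add, map_smul μ z (h k m), hμ, one_smul, ih, hD, smul_sub,
        smul_smul z (z ^ k) m, smul_smul z (z ^ k) (nab m), ← pow_succ']
      abel
  -- the commutator with `z` telescopes
  have h_comm : ∀ k (m : N),
      z • h k m - h k (z • m) = (z ^ k) ⊗ₜ[S] D m - (1 : B) ⊗ₜ[S] D (z ^ k • m) := by
    intro k
    induction k with
    | zero => intro m; simp only [h_zero, smul_zero, sub_self, pow_zero, one_smul]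
    | succ k ih =>
      intro m
      have ih' :
          z • h k m = h k (z • m) + ((z ^ k) ⊗ₜ[S] D m - (1 : B) ⊗ₜ[S] D (z ^ k • m)) := by
        rw [← ih m]; abel
      rw [h_succ, h_succ, smul_add, ih', smul_add, smul_sub, TensorProduct.smul_tmul',
        TensorProduct.smul_tmul', smul_eq_mul, mul_one, smul_eq_mul, ← pow_succ',
        smul_smul (z ^ k) z m, ← pow_succ]
      abel
  -- at `k = n` the commutator vanishes: `zⁿ ⊗ D m = -F ⊗ D m = -(1 ⊗ F • D m) = 1 ⊗ D (zⁿ m)`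
  have h_z : ∀ m : N, h n (z • m) = z • h n m := by
    intro m
    have hFD : D (z ^ n • m) = -(F • D m) := by
      rw [hzn, neg_smul, algebraMap_smul, map_neg, map_smul]
    have e := h_comm n m
    rw [hFD, TensorProduct.tmul_neg, hzn, TensorProduct.neg_tmul, Algebra.algebraMap_eq_smul_one,
      TensorProduct.smul_tmul, sub_neg_eq_add, neg_add_cancel, sub_eq_zero] at e
    exact e.symm
  -- hence `h n` is `B`-linear (`B = S[z]`)
  have h_B : ∀ (b : B) (m : N), h n (b • m) = b • h n m := by
    intro b
    have hb : b ∈ Algebra.adjoin S ({z} : Set B) := by rw [hz]; exact Algebra.mem_top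
    refine Algebra.adjoin_induction (p := fun b _ => ∀ m : N, h n (b • m) = b • h n m)
      ?_ ?_ ?_ ?_ hb
    · intro x hx m
      rw [Set.mem_singleton_iff.mp hx]
      exact h_z m
    · intro s m
      rw [algebraMap_smul, h_smul, algebraMap_smul]
    · intro x y _ _ hx hy m
      rw [add_smul, h_add, hx, hy, add_smul]
    · intro x y _ _ hx hy m
      rw [mul_smul, hx, hy, mul_smul]
  let ιB : N →ₗ[B] B ⊗[S] N :=
    { toFun := h n
      map_add' := h_add n
      map_smul' := fun b m => h_B b m }
  refine ⟨-ιB, LinearMap.ext fun m => ?_⟩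
  change μ (-(h n m)) = algebraMap S B (δ F) • m
  rw [map_neg, h_mu, hzn, neg_smul, neg_smul, algebraMap_smul, algebraMap_smul, sub_neg_eq_add,
    map_neg, hnab F m, algebraMap_smul]
  abel

/-- **Derivation homotopy (stable factorisation form).** With `B = S[z]`, `zⁿ + F = 0` as above,
for every derivation `δ` of `S` and every `B`-module `N` that is PROJECTIVE over `S`, the homothety
`(δ F) • 1_N` factors `B`-linearly through the `B`-projective module `B ⊗_S N`:
`π ∘ ι = (δ F) • id` for some `ι : N → B ⊗_S N`, `π : B ⊗_S N → N`
(`exists_connection` + `exists_liftBaseChange_comp_eq_smul_id_of_connection`). [folklore] -/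
theorem exists_comp_eq_smul_id {R : Type*} [CommRing R] [Algebra R S] (δ : Derivation R S S)
    {z : B} (hz : Algebra.adjoin S {z} = ⊤) {n : ℕ} {F : S} (hzF : z ^ n + algebraMap S B F = 0)
    (N : Type v) [AddCommGroup N] [Module B N] [Module S N] [IsScalarTower S B N]
    [Module.Projective S N] :
    ∃ (ι : N →ₗ[B] B ⊗[S] N) (π : B ⊗[S] N →ₗ[B] N),
      π ∘ₗ ι = algebraMap S B (δ F) • LinearMap.id := by
  obtain ⟨nab, hnab⟩ := exists_connection δ N
  obtain ⟨ι, hι⟩ := exists_liftBaseChange_comp_eq_smul_id_of_connection hz hzF (δ : S → S) nab hnab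
  exact ⟨ι, _, hι⟩

/-- **`δ F` kills `Ext^{≥ 1}` of `S`-projective `B`-modules (exponent one, characteristic-free).**
With `B = S[z]`, `zⁿ + F = 0`, `δ` a derivation of `S` and `N` a `B`-module projective over `S`:
`(δ F) • Extⁱ_B(N, M) = 0` for every `B`-module `M` and every `i ≥ 1` — stable annihilation
(`exists_comp_eq_smul_id`, `B ⊗_S N` is `B`-projective) kills positive `Ext`
(`smul_ext_eq_zero_of_linearMap_comp_eq_smul_id`). [folklore] -/
theorem smul_ext_eq_zero_of_derivation {R : Type*} [CommRing R] [Algebra R S]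
    (δ : Derivation R S S) {z : B} (hz : Algebra.adjoin S {z} = ⊤) {n : ℕ} {F : S}
    (hzF : z ^ n + algebraMap S B F = 0) (N : Type u) [AddCommGroup N] [Module B N] [Module S N]
    [IsScalarTower S B N] [Module.Projective S N] (M : ModuleCat.{u} B) {i : ℕ} (hi : 1 ≤ i)
    (e : Ext.{u} (ModuleCat.of B N) M i) : algebraMap S B (δ F) • e = 0 := by
  obtain ⟨ι, π, h⟩ := exists_comp_eq_smul_id δ hz hzF N
  exact smul_ext_eq_zero_of_linearMap_comp_eq_smul_id ι π h M hi e

end Homotopy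

/-! ## The card's shape: `B = S[X]/(Xⁿ + F)` -/

section AdjoinRoot

open Polynomial

variable {S : Type u} [CommRing S]

/-- In `S[X]/(Xⁿ + C F)` the class `z` of `X` satisfies `zⁿ + F = 0`. [folklore] -/
theorem root_pow_add_algebraMap_eq_zero (n : ℕ) (F : S) :
    AdjoinRoot.root (X ^ n + C F : S[X]) ^ n +
      algebraMap S (AdjoinRoot (X ^ n + C F : S[X])) F = 0 := by
  have h := AdjoinRoot.eval₂_root (X ^ n + C F : S[X])
  rwa [eval₂_add, eval₂_X_pow, eval₂_C, ← AdjoinRoot.algebraMap_eq] at h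

/-- **Card A3-W1 `HomotopyLemma`** (res-L1-w44b-idea-1), in its `ModuleCat` shape: over
`B = S[X]/(Xⁿ + F)`, for every `B`-module `N` projective over `S` and every derivation `δ` of `S`,
the homothety `(δ F) • 𝟙 N` factors through a projective object of `ModuleCat B` (namely
`B ⊗_S N`): `δ F` lies in the stable annihilator of `N`. (The card's hypotheses `Module.Finite S N`
and `1 ≤ n` are not needed.) [folklore] -/
theorem exists_projective_comp_eq_smul_id_adjoinRoot {R : Type*} [CommRing R] [Algebra R S]
    (δ : Derivation R S S) (n : ℕ) (F : S) (N : Type u) [AddCommGroup N]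
    [Module (AdjoinRoot (X ^ n + C F : S[X])) N] [Module S N]
    [IsScalarTower S (AdjoinRoot (X ^ n + C F : S[X])) N] [Module.Projective S N] :
    ∃ (P : ModuleCat.{u} (AdjoinRoot (X ^ n + C F : S[X]))) (_ : Projective P)
      (ι : ModuleCat.of _ N ⟶ P) (π : P ⟶ ModuleCat.of _ N),
      ι ≫ π = algebraMap S (AdjoinRoot (X ^ n + C F : S[X])) (δ F) • 𝟙 (ModuleCat.of _ N) := by
  set B := AdjoinRoot (X ^ n + C F : S[X])
  obtain ⟨ι, π, h⟩ := exists_comp_eq_smul_id δ (AdjoinRoot.adjoinRoot_eq_top (f := X ^ n + C F))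
    (root_pow_add_algebraMap_eq_zero n F) N
  exact ⟨ModuleCat.of B (B ⊗[S] N), (IsProjective.iff_projective (R := B) (B ⊗[S] N)).mp
    inferInstance, ModuleCat.ofHom ι, ModuleCat.ofHom π,
    (ModuleCat.comp_eq_smul_id_iff _ _ _).mpr h⟩

/-- **Card A3-W1, `Ext` form**: over `B = S[X]/(Xⁿ + F)`, `(δ F) • Extⁱ_B(N, M) = 0` for every
`B`-module `N` projective over `S`, every `B`-module `M`, every derivation `δ` of `S` and every
`i ≥ 1` (exponent one, characteristic-free). [folklore] -/
theorem smul_ext_eq_zero_of_derivation_adjoinRoot {R : Type*} [CommRing R] [Algebra R S]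
    (δ : Derivation R S S) (n : ℕ) (F : S) (N : Type u) [AddCommGroup N]
    [Module (AdjoinRoot (X ^ n + C F : S[X])) N] [Module S N]
    [IsScalarTower S (AdjoinRoot (X ^ n + C F : S[X])) N] [Module.Projective S N]
    (M : ModuleCat.{u} (AdjoinRoot (X ^ n + C F : S[X]))) {i : ℕ} (hi : 1 ≤ i)
    (e : Ext.{u} (ModuleCat.of _ N) M i) :
    algebraMap S (AdjoinRoot (X ^ n + C F : S[X])) (δ F) • e = 0 :=
  smul_ext_eq_zero_of_derivation δ (AdjoinRoot.adjoinRoot_eq_top (f := X ^ n + C F))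
    (root_pow_add_algebraMap_eq_zero n F) N M hi e

end AdjoinRoot

/-! ## Card A3-W2: the Frobenius chain rule -/

section Frobenius

/-- **Card A3-W2 `FrobeniusChainRule`** (res-L1-w44b-idea-1): in characteristic `p` a derivation
does not see `p`-th powers — `δ (F + φᵖ) = δ F` and `δ (uᵖ F) = uᵖ δ F` (`δ (aᵖ) = p aᵖ⁻¹ δ a = 0`).
So the Jacobian datum `δ F` of `zᵖ + F` is invariant under Tschirnhaus cleaning `F ↦ F + φᵖ` and
`p`-th power rescaling. [folklore] -/
theorem frobeniusChainRule (p : ℕ) [Fact p.Prime] {R S : Type*} [CommRing R] [CommRing S]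
    [Algebra R S] [CharP S p] (δ : Derivation R S S) (F φ u : S) :
    δ (F + φ ^ p) = δ F ∧ δ (u ^ p * F) = u ^ p * δ F := by
  have hp : ∀ a : S, δ (a ^ p) = 0 := fun a => by
    rw [Derivation.leibniz_pow, ← Nat.cast_smul_eq_nsmul S, smul_eq_mul,
      CharP.cast_eq_zero, zero_mul]
  refine ⟨by rw [map_add, hp, add_zero], ?_⟩
  rw [Derivation.leibniz, hp, smul_zero, add_zero, smul_eq_mul]

end Frobenius

end Summit.ResolutionOfSingularities.ResolutionOfSingularities.Theorems.HomologicalConductor.PersistenceDerivationHomotopy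

end
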